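import Summits.HodgeConjecture.HodgeCM.Model.ArchKTypeOfCentralWeight_2
import Summits.HodgeConjecture.HodgeCM.Model.ArchKTypeOfLambdaDef
import Summits.HodgeConjecture.HodgeCM.Model.ArchKTypeOfLineTables
import Summits.HodgeConjecture.HodgeCM.Model.ArchKTypeOfSection
import Summits.HodgeConjecture.HodgeCM.PerL34.NormOneRelTorusCircles
import Literature.RepresentationTheory.CompactGroups.CircleCharacters
import HarnessLib

/-!
# FLOOR-0 P4, S4b — DET-RIGIDITY of a character of `U(V)(𝔸)` on the archimedean compact factors, and the archimedean CENTRE concentrated at one place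
# (the two tools of ★ `Theorems/H413ThetaDistAtLineArchTypes`: archimedean type rows ⇐ centre identity (CC₀))

Cell hodgecm-mathlib (D-0151), FLOOR 0, crux item H413 = stmt-HodgeConjecture-24833; programme P4, line
`Cruxes/H413/Lines/F0_P4AdmissibleOccursInH1.lean` (ED. 2.1), stub S4b `stub_T3a_holThetaAtAdmissibleLineOfRallisAt` (lead F0P4-p01).  Author F0P4-p04
(g2).  `--supports stmt-HodgeConjecture-24833 --as helper`.  KERNEL ONLY: theorems over LANDED model-layer theorems; nothing is cited as a fact, no
`sorry`, no definition.

WHY.  At a general weight-one `μ` the slot-`0` character `Ξ := lineCharV_zero … η₀` of ★ `ThetaDistAtLine.sideAt` is (the `V`-part of) the GLOBAL central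
twist between the `μ`-splitting and the model's chosen splitting — a continuous automorphic character of `U(V)(𝔸)` whose archimedean TYPE (the rows
`hχ₀`, `hdefT` of ★ `Theorems/H413ThetaDistAtLineArchRows`) is a theorem, not a knob.  The sequel reads that type OFF THE CENTRE; this file supplies the two
kernel tools:

* §0 scalar facts: `int_eq_zero_of_forall_circle_zpow_eq_one` (★ `CircleChar.existsUnique_zpow_complex`), `star_eq_zpow_neg_one_of_unitary`;
* §1 **det-rigidity**: a continuous character `Ξ` of `U(V)(𝔸)` reads `det(u)^c` on the one-place elements `(archSingle (w b) u)^𝔸` at a definite `b ≠ v₁`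
  (`exists_zpow_archSingle_of_continuous`, ★ `U3FormChar.exists_zpow_of_continuous_form` through ★ `archLocal_eq_form`, pattern of ★ `exists_defLambdaExponent`)
  and `(det A · d)^c` on the `ι₁`-section points over `K = U(2) × U(1)` (`exists_zpow_section_of_continuous`, ★ `U21Char.exists_zpow_of_continuous`);
* §2 **the centre concentrated at one place**: for `t ∈ U(1)(L⁺ ⊗ ℝ) ≅ ∏_w U(1)` (★ `NumberField.unitaryLineArchTorusContinuousMulEquiv`) with coordinate `ζ` at
  ONE complex place and `1` elsewhere, `t · 1₃ = cmArchCenter t` IS the one-place element `archSingle (w b) (ζ · 1₃)` (`cmArchCenter_equivCircles_symm_mulSingle`,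
  determinant `ζ³`: `det_archAt_cmArchCenter_equivCircles_symm_mulSingle`), and at `w(ι₁)` it IS the `ι₁`-section at the central `ζ · 1 ∈ K`
  (`cmArchCenter_equivCircles_symm_mulSingle_cmPlace`, under the canonical-representative guard `(mk ι₁).embedding = ι₁`; ★ `coe_archAt_cmArchCenter_apply`,
  `coe_archAt_archSectionFrameOf_centralK_apply`, `archAt_archSectionFrameOf_of_ne`).

HC_CM is proved only modulo the printed citations until rung 0 closes.

## References
* Tree (all ★): `HodgeCM/Model/ArchKTypeOfCentralWeight_1/_2` (`centralK`, `centerCoord`, `coe_archAt_archSectionFrameOf_centralK_apply`),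
  `HodgeCM/Model/ArchLineDatumOf_1` (`coe_archAt_cmArchCenter`, `centerPlaceCircles`), `HodgeCM/Model/ArchKTypeOfLambdaDef` (`archLocal_eq_form`, `placeEntries_*`),
  `HodgeCM/Model/ArchUnitaryFormDetChar` (`U3FormChar.exists_zpow_of_continuous_form`), `HodgeCM/Model/ArchKTypeOfLineTables` (`placeUnder`, `cmPlaceOver_placeUnder`), `HodgeCM/Model/ArchU21Characters_2` (`U21Char.exists_zpow_of_continuous`,
  `circleToUnitary`), `HodgeCM/Model/ArchKTypeOfSection` (`archAt_archSectionFrameOf_of_ne`), `HodgeCM/Model/ArchKTypeOfArch` (`cmFrameEquiv_archSectionU21CM`),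
  `HodgeCM/PerL34/NormOneRelTorusCircles` (`unitaryLineArchTorusContinuousMulEquiv`), `Literature/NumberTheory/Automorphic/UnitaryGroupArchimedeanPlaces`
  (`archPiEquiv`, `archAt_archPiEquiv_symm`), `Literature/RepresentationTheory/CompactGroups/CircleCharacters` (`existsUnique_zpow_complex`).
* [BrockerTomDieck1985] T. Bröcker, T. tom Dieck, *Representations of Compact Lie Groups*, GTM 98 (1985), II (8.1).
  [PlatonovRapinchuk1994] V. Platonov, A. Rapinchuk, *Algebraic Groups and Number Theory* (1994), §6.2 (archimedean tori).
  [BorelJacquet1979] A. Borel, H. Jacquet, Corvallis PSPM 33.1, §4.1 (`G(F ⊗ ℝ) = ∏_v G(F_v)`).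
-/

set_option autoImplicit false
set_option linter.dupNamespace false

noncomputable section

open NumberField hiding relNormOneIdeles relNormOneRat probHaarRelNormOneQuot
open _root_.NumberField.InfinitePlace _root_.NumberField.mixedEmbedding MeasureTheory MulAction IsDedekindDomain
open scoped Matrix TensorProduct Classical SchwartzMap
open Literature.Geometry.ComplexHyperbolic.BallModel (U21 x₀ stabilizerEquivK21 blockK blockU mat coe_blockK stabilizerEquivK21_apply)
open Literature.NumberTheory.Automorphic.U21 (K21 matA sclD)
open Literature.NumberTheory.Automorphic Literature.NumberTheory.Automorphic.UnitaryGroup Literature.NumberTheory.Weil1964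
open Literature.NumberTheory.GelbartRogawski1991 Literature.NumberTheory.GelbartRogawski1991.UnitaryDualPair
open Literature.AlgebraicGeometry.HodgeTheory Literature.AlgebraicGeometry.ShimuraVarieties Literature.AlgebraicGeometry.ShimuraVarieties.BallForms
open Literature.AlgebraicGeometry.Motives (CMType)
open Literature.RepresentationTheory.KonnoKonno2007 Literature.RepresentationTheory.KonnoKonno2007.RealDualPair
open Literature.Analysis.SegalBargmann
open HodgeCM HodgeCM.Adelic HodgeCM.PerL34 HodgeCM.Model HodgeCM.Model.HypCensus HodgeCM.Model.ArchSideTerm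

namespace Summit.HodgeConjecture.HodgeConjecture.Cruxes.H413.ThetaDistAtLine

/-! ## §0 Two scalar facts -/

/-- an integer power that is `1` on the whole circle is the zeroth power. [folklore; via ★ `CircleChar.existsUnique_zpow_complex`] -/
theorem int_eq_zero_of_forall_circle_zpow_eq_one {n : ℤ} (h : ∀ ζ : Circle, ((ζ : ℂ)) ^ n = 1) : n = 0 := by
  obtain ⟨m, -, huniq⟩ := Literature.RepresentationTheory.CompactGroups.CircleChar.existsUnique_zpow_complex (1 : Circle →* ℂ) continuous_const
  have h1 : n = m := huniq n fun ζ => by rw [MonoidHom.one_apply, h ζ]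
  have h2 : (0 : ℤ) = m := huniq 0 fun ζ => by rw [MonoidHom.one_apply, zpow_zero]
  rw [h1, ← h2]

/-- `d̄ = d⁻¹` as a `zpow`, for a unit complex number. [folklore] -/
theorem star_eq_zpow_neg_one_of_unitary {d : ℂ} (hd : d ∈ unitary ℂ) : star d = d ^ (-1 : ℤ) := by
  have h1 : star d * d = 1 := Unitary.coe_star_mul_self ⟨d, hd⟩
  have hd0 : d ≠ 0 := fun h => by rw [h, mul_zero] at h1; exact zero_ne_one h1
  rw [zpow_neg_one]
  exact eq_inv_of_mul_eq_one_left h1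

/-! ## §1 Det-rigidity of a continuous character of `U(V)(𝔸)` on the archimedean compact factors -/

section Rigidity

variable {L : CMField} {ι₁ : L →+* ℂ} (V : HermSpace3 L ι₁)
variable (Ξ : CMAdelic (L : Type) (frameD V) →* ℂˣ) (hΞc : Continuous fun v => ((Ξ v : ℂˣ) : ℂ))

include hΞc in
/-- **det-rigidity at a definite place**: at a real place `b ≠ v₁` of `L⁺` (where `U(V)(L_b) ≅ U(3)` is compact: `frameD_sign_of_ne`), a continuous character
`Ξ` of `U(V)(𝔸)` reads `u ↦ det(u)^c` on the one-place elements `(archSingle (w b) u)^𝔸`, for ONE integer `c` (pattern of ★ `exists_defLambdaExponent`).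
[cite: BrockerTomDieck1985, II (8.1)] -/
theorem exists_zpow_archSingle_of_continuous (b : {v : InfinitePlace ↥(maximalRealSubfield L) // v.IsReal}) (hb : b ≠ HypCensus.cmPlace (L : Type) ι₁) :
    ∃ c : ℤ, ∀ u : UnitaryGroup.archLocal (L : Type) 3 (Matrix.diagonal (frameD V)) (cmPlaceOver (L : Type) b),
      ((Ξ (UnitaryGroup.archToAdelic (↥(maximalRealSubfield L)) L (IsCMField.complexConj L) 3 (Matrix.diagonal (frameD V))
            (UnitaryGroup.archSingle (↥(maximalRealSubfield L)) L (IsCMField.complexConj L) 3 (Matrix.diagonal (frameD V))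
              (IsCMField.complexConj_ne_one L) (NumberField.complexConj_smul_infinitePlace (L : Type)) (cmPlaceOver (L : Type) b) u)) : ℂˣ) : ℂ) =
        (((u : UnitaryGroup.archLocal (L : Type) 3 (Matrix.diagonal (frameD V)) (cmPlaceOver (L : Type) b)) : GL (Fin 3) ℂ) :
          Matrix (Fin 3) (Fin 3) ℂ).det ^ c := by
  -- the character read on `unitaryGroupOfForm conj (diagonal h)` through the identity of subgroups (★ `archLocal_eq_form`)
  let e := MulEquiv.subgroupCongr (archLocal_eq_form V b)
  let χ₀ : UnitaryGroup.archLocal (L : Type) 3 (Matrix.diagonal (frameD V)) (cmPlaceOver (L : Type) b) →* ℂˣ :=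
    Ξ.comp ((UnitaryGroup.archToAdelic (↥(maximalRealSubfield L)) L (IsCMField.complexConj L) 3 (Matrix.diagonal (frameD V))).comp
      (UnitaryGroup.archSingle (↥(maximalRealSubfield L)) L (IsCMField.complexConj L) 3 (Matrix.diagonal (frameD V))
        (IsCMField.complexConj_ne_one L) (NumberField.complexConj_smul_infinitePlace (L : Type)) (cmPlaceOver (L : Type) b)))
  have hχ₀ : Continuous fun u => ((χ₀ u : ℂˣ) : ℂ) :=
    hΞc.comp ((UnitaryGroup.continuous_archToAdelic (↥(maximalRealSubfield L)) L (IsCMField.complexConj L) 3 (Matrix.diagonal (frameD V))).comp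
      (UnitaryGroup.continuous_archSingle (↥(maximalRealSubfield L)) L (IsCMField.complexConj L) 3 (Matrix.diagonal (frameD V))
        (IsCMField.complexConj_ne_one L) (NumberField.complexConj_smul_infinitePlace (L : Type)) (cmPlaceOver (L : Type) b)))
  let χ : ↥(unitaryGroupOfForm (starRingEnd ℂ) (Matrix.diagonal (placeEntries V b))) →* ℂˣ := χ₀.comp e.symm.toMonoidHom
  have he : Continuous fun g : ↥(unitaryGroupOfForm (starRingEnd ℂ) (Matrix.diagonal (placeEntries V b))) => e.symm g :=
    Continuous.subtype_mk continuous_subtype_val _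
  have hχ : Continuous fun g => ((χ g : ℂˣ) : ℂ) := hχ₀.comp he
  obtain ⟨m, hm⟩ := U3FormChar.exists_zpow_of_continuous_form (placeEntries V b) (placeEntries_real V b) (placeEntries_sign V hb) χ hχ
  refine ⟨m, fun u => ?_⟩
  have h := hm (e u)
  have h1 : e.symm (e u) = u := e.symm_apply_apply u
  simp only [χ, χ₀, MonoidHom.comp_apply, MulEquiv.coe_toMonoidHom, h1] at h
  exact h

include hΞc in
/-- **det-rigidity on `K ⊂ U(2,1)` along the `ι₁`-section**: a continuous character `Ξ` of `U(V)(𝔸)` reads `(det A · d)^c` on the section points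
`(archSectionFrameOf V (diag(A, d)))^𝔸`, for ONE integer `c` (★ `U21Char.exists_zpow_of_continuous`, continuity along `z ↦ diag(z,1,1)` as in ★
`continuous_lambdaChar`). [cite: BrockerTomDieck1985, II (8.1)] -/
theorem exists_zpow_section_of_continuous :
    ∃ c : ℤ, ∀ k : K21,
      ((Ξ (UnitaryGroup.archToAdelic (↥(maximalRealSubfield L)) L (IsCMField.complexConj L) 3 (Matrix.diagonal (frameD V))
          (archSectionFrameOf V (blockU k))) : ℂˣ) : ℂ) = ((matA k).det * sclD k) ^ c := by
  let χ : U21 →* ℂˣ :=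
    Ξ.comp ((UnitaryGroup.archToAdelic (↥(maximalRealSubfield L)) L (IsCMField.complexConj L) 3 (Matrix.diagonal (frameD V))).comp
      (archSectionFrameOf V))
  have hc : Continuous fun u : U21 => ((χ u : ℂˣ) : ℂ) := by
    have he : (fun u : U21 => ((χ u : ℂˣ) : ℂ)) =
        (fun v => ((Ξ v : ℂˣ) : ℂ)) ∘
          fun u : U21 => cmFrameEquiv (L : Type) (frameG V) V.Hm (frameD V) (frame_congr V)
            (UnitaryGroup.archSectionU21CM (L : Type) ι₁ V.Hm V.sylvesterFrame (sylvesterFrame_J V) u) := by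
      funext u
      rw [Function.comp_apply, cmFrameEquiv_archSectionU21CM]
      rfl
    rw [he]
    exact hΞc.comp ((continuous_cmFrameEquiv (L : Type) (frameG V) V.Hm (frameD V) (frame_congr V)).comp
      (UnitaryGroup.continuous_archSectionU21CM (L : Type) ι₁ V.Hm V.sylvesterFrame (sylvesterFrame_J V)))
  obtain ⟨c, hcK⟩ := U21Char.exists_zpow_of_continuous χ (hc.comp U21Char.continuous_D₀_circle)
  exact ⟨c, fun k => hcK k⟩

end Rigidity

/-! ## §2 The archimedean centre of `U(V)(L ⊗ ℝ)` concentrated at one place -/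

section Center

variable {L : CMField} {ι₁ : L →+* ℂ} (V : HermSpace3 L ι₁)

omit V in
/-- the archimedean unit of `U(1)(L⁺ ⊗ ℝ) ≅ ∏_w U(1)` with coordinate `ζ` at `w` and `1` elsewhere (★ `NumberField.unitaryLineArchTorusContinuousMulEquiv`) has these place
coordinates. [folklore] -/
theorem archPlaceChar_equivCircles_symm_mulSingle (w w' : InfinitePlace (L : Type)) (ζ : Circle) :
    NumberField.archPlaceChar (L : Type) w' ((NumberField.unitaryLineArchTorusContinuousMulEquiv (L : Type)).symm (Pi.mulSingle w ζ)) =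
      (Pi.mulSingle w ζ : InfinitePlace (L : Type) → Circle) w' := by
  change (NumberField.unitaryLineArchTorusContinuousMulEquiv (L : Type)
    ((NumberField.unitaryLineArchTorusContinuousMulEquiv (L : Type)).symm (Pi.mulSingle w ζ))) w' = _
  rw [ContinuousMulEquiv.apply_symm_apply]

/-- an archimedean element all of whose place components but the `w₀`-th are trivial IS the one-place element of its `w₀`-component. [folklore] -/
theorem eq_archSingle_of_archAt_eq_one (g : UnitaryGroup.arch (↥(maximalRealSubfield L)) L (IsCMField.complexConj L) 3 (Matrix.diagonal (frameD V)))
    (w₀ : {w : InfinitePlace (L : Type) // w.IsComplex})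
    (h : ∀ w : {w : InfinitePlace (L : Type) // w.IsComplex}, w ≠ w₀ →
      UnitaryGroup.archAt (↥(maximalRealSubfield L)) L (IsCMField.complexConj L) 3 (Matrix.diagonal (frameD V)) w
        (NumberField.complexConj_smul_infinitePlace (L : Type) _) (IsCMField.complexConj_ne_one (L : Type)) g = 1) :
    g = UnitaryGroup.archSingle (↥(maximalRealSubfield L)) L (IsCMField.complexConj L) 3 (Matrix.diagonal (frameD V))
          (IsCMField.complexConj_ne_one L) (NumberField.complexConj_smul_infinitePlace (L : Type)) w₀
          (UnitaryGroup.archAt (↥(maximalRealSubfield L)) L (IsCMField.complexConj L) 3 (Matrix.diagonal (frameD V)) w₀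
            (NumberField.complexConj_smul_infinitePlace (L : Type) _) (IsCMField.complexConj_ne_one (L : Type)) g) := by
  apply (UnitaryGroup.archPiEquiv (↥(maximalRealSubfield L)) L (IsCMField.complexConj L) 3 (Matrix.diagonal (frameD V))
    (IsCMField.complexConj_ne_one L) (NumberField.complexConj_smul_infinitePlace (L : Type))).injective
  funext w
  rw [UnitaryGroup.archPiEquiv_apply, UnitaryGroup.archPiEquiv_apply]
  by_cases hw : w = w₀
  · subst hw
    rw [UnitaryGroup.archAt_archSingle_self]
  · rw [UnitaryGroup.archAt_archSingle_of_ne _ _ _ _ _ _ _ _ hw, h w hw]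

/-- the place component of the archimedean centre `t · 1₃` at a complex place where `t` has coordinate `1` is trivial. [folklore] -/
theorem archAt_cmArchCenter_eq_one_of_archPlaceChar_eq_one
    (t : ↥(Literature.NumberTheory.Automorphic.relNormOneInfUnits (↥(maximalRealSubfield L)) L))
    (w : {w : InfinitePlace (L : Type) // w.IsComplex}) (ht : NumberField.archPlaceChar (L : Type) w.1 t = 1) :
    UnitaryGroup.archAt (↥(maximalRealSubfield L)) L (IsCMField.complexConj L) 3 (Matrix.diagonal (frameD V)) w
        (NumberField.complexConj_smul_infinitePlace (L : Type) _) (IsCMField.complexConj_ne_one (L : Type))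
        (cmArchCenter (L : Type) 3 (Matrix.diagonal (frameD V)) t) = 1 := by
  have hw : cmPlaceOver (L : Type) (placeUnder w.1) = w := Subtype.ext (cmPlaceOver_placeUnder w.1)
  rw [← hw] at ht ⊢
  apply Subtype.ext
  apply Units.ext
  rw [coe_archAt_cmArchCenter (L : Type) (frameD V) (placeUnder w.1) t, OneMemClass.coe_one, Units.val_one]
  ext i j
  rw [Matrix.diagonal_apply, Matrix.one_apply, centerPlaceCircles_apply, ht]
  rfl

/-- **the centre concentrated at ONE place is a one-place element**: for `t` with coordinate `ζ` at `w(b)` and `1` elsewhere, `t · 1₃ = archSingle (w b) ((t · 1₃)_{w b})`.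
[folklore] -/
theorem cmArchCenter_equivCircles_symm_mulSingle (b : {v : InfinitePlace ↥(maximalRealSubfield L) // v.IsReal}) (ζ : Circle) :
    cmArchCenter (L : Type) 3 (Matrix.diagonal (frameD V)) ((NumberField.unitaryLineArchTorusContinuousMulEquiv (L : Type)).symm (Pi.mulSingle (cmPlaceOver (L : Type) b).1 ζ)) =
      UnitaryGroup.archSingle (↥(maximalRealSubfield L)) L (IsCMField.complexConj L) 3 (Matrix.diagonal (frameD V))
        (IsCMField.complexConj_ne_one L) (NumberField.complexConj_smul_infinitePlace (L : Type)) (cmPlaceOver (L : Type) b)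
        (UnitaryGroup.archAt (↥(maximalRealSubfield L)) L (IsCMField.complexConj L) 3 (Matrix.diagonal (frameD V)) (cmPlaceOver (L : Type) b)
          (NumberField.complexConj_smul_infinitePlace (L : Type) _) (IsCMField.complexConj_ne_one (L : Type))
          (cmArchCenter (L : Type) 3 (Matrix.diagonal (frameD V)) ((NumberField.unitaryLineArchTorusContinuousMulEquiv (L : Type)).symm (Pi.mulSingle (cmPlaceOver (L : Type) b).1 ζ)))) :=
  eq_archSingle_of_archAt_eq_one V _ _ fun w hw =>
    archAt_cmArchCenter_eq_one_of_archPlaceChar_eq_one V _ w (by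
      rw [archPlaceChar_equivCircles_symm_mulSingle, Pi.mulSingle_eq_of_ne]
      exact fun h => hw (Subtype.ext h))

/-- … and its `w(b)`-component is the scalar `ζ · 1₃`, of determinant `ζ³`. [folklore] -/
theorem det_archAt_cmArchCenter_equivCircles_symm_mulSingle (b : {v : InfinitePlace ↥(maximalRealSubfield L) // v.IsReal}) (ζ : Circle) :
    (((UnitaryGroup.archAt (↥(maximalRealSubfield L)) L (IsCMField.complexConj L) 3 (Matrix.diagonal (frameD V)) (cmPlaceOver (L : Type) b)
          (NumberField.complexConj_smul_infinitePlace (L : Type) _) (IsCMField.complexConj_ne_one (L : Type))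
          (cmArchCenter (L : Type) 3 (Matrix.diagonal (frameD V)) ((NumberField.unitaryLineArchTorusContinuousMulEquiv (L : Type)).symm (Pi.mulSingle (cmPlaceOver (L : Type) b).1 ζ))) :
        UnitaryGroup.archLocal (L : Type) 3 (Matrix.diagonal (frameD V)) (cmPlaceOver (L : Type) b)) : GL (Fin 3) ℂ) : Matrix (Fin 3) (Fin 3) ℂ).det =
      ((ζ : ℂ)) ^ (3 : ℤ) := by
  rw [coe_archAt_cmArchCenter (L : Type) (frameD V) b, Matrix.det_diagonal]
  simp only [centerPlaceCircles_apply, archPlaceChar_equivCircles_symm_mulSingle, Pi.mulSingle_eq_same, Finset.prod_const, Finset.card_univ,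
    Fintype.card_fin]
  norm_cast

/-- the `w(ι₁)`-coordinate `centerCoord` of ★ `ArchKTypeOfCentralWeight` IS the weight character at `w(ι₁)`. [folklore] -/
theorem centerCoord_eq_archPlaceChar (t : ↥(Literature.NumberTheory.Automorphic.relNormOneInfUnits (↥(maximalRealSubfield L)) L)) :
    centerCoord (L : Type) ι₁ t = ((NumberField.archPlaceChar (L : Type) (UnitaryGroup.cmPlace (L : Type) ι₁).1 t : Circle) : ℂ) := rfl

/-- **the centre concentrated at `w(ι₁)` is the `ι₁`-section at the central `ζ · 1 ∈ K`** (under the canonical-representative guard `(mk ι₁).embedding = ι₁`).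
[folklore] -/
theorem cmArchCenter_equivCircles_symm_mulSingle_cmPlace (hemb : (InfinitePlace.mk ι₁).embedding = ι₁) (ζ : Circle) :
    cmArchCenter (L : Type) 3 (Matrix.diagonal (frameD V))
        ((NumberField.unitaryLineArchTorusContinuousMulEquiv (L : Type)).symm (Pi.mulSingle (UnitaryGroup.cmPlace (L : Type) ι₁).1 ζ)) =
      archSectionFrameOf V ((blockK (centralK (U21Char.circleToUnitary ζ)) : stabilizer U21 x₀) : U21) := by
  apply (UnitaryGroup.archPiEquiv (↥(maximalRealSubfield L)) L (IsCMField.complexConj L) 3 (Matrix.diagonal (frameD V))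
    (IsCMField.complexConj_ne_one L) (NumberField.complexConj_smul_infinitePlace (L : Type))).injective
  funext w
  rw [UnitaryGroup.archPiEquiv_apply, UnitaryGroup.archPiEquiv_apply]
  by_cases hw : w = UnitaryGroup.cmPlace (L : Type) ι₁
  · subst hw
    refine Subtype.ext (Units.ext (Matrix.ext fun i j => ?_))
    rw [coe_archAt_cmArchCenter_apply, coe_archAt_archSectionFrameOf_centralK_apply, UnitaryGroup.embTwist_apply_of_eq (L : Type) ι₁ hemb,
      U21Char.coe_circleToUnitary, centerCoord_eq_archPlaceChar, archPlaceChar_equivCircles_symm_mulSingle, Pi.mulSingle_eq_same]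
  · rw [archAt_archSectionFrameOf_of_ne V hw,
      archAt_cmArchCenter_eq_one_of_archPlaceChar_eq_one V _ w (by
        rw [archPlaceChar_equivCircles_symm_mulSingle, Pi.mulSingle_eq_of_ne]
        exact fun h => hw (Subtype.ext h))]

end Center

end Summit.HodgeConjecture.HodgeConjecture.Cruxes.H413.ThetaDistAtLine

end
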